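import Mathlib
import HarnessLib
import Summits.HubbardSuperconductivity.HubbardSuperconductivity.Theorems.KLProgrammeKLRegimeVolumeLimitNestedCarrierRate
import Summits.HubbardSuperconductivity.HubbardSuperconductivity.Theorems.KLProgrammeKLRegimeVolumeLimitCutoffDoorsV14

/-!
# VL children `VolumeLimitP2 Pr FinalTwoLegVolLimitEx W` — a BUNDLE-GENERIC closure from the three stub texts of skeleton «cauchy» v3
# (bound + six-point bound + ONE same-cutoff carrier export; arbitrary-pair or NESTED form)
# (cell gate-hubbard-kl, seat hubbard-kl-k3c5-p3 g5, technique «OS-positivity-free direct assembly»; `--supports` stmt-…-19921)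

The VL child has been re-typed five times (`klPredsV7 → V10 → V11 → V12 → V14`, skeletons «cauchy» v1 → v2 → v3) with the SAME slot `FinalTwoLegVolLimitEx`
and the SAME stub contents; each time the composition and the doors were re-targeted by hand (`…_V14` wrappers).  None of the doors reads the bundle:
the prefix hypotheses `Pr.frameOK …` / `TowerP Pr …` are only threaded.  This module states the closure ONCE for every bundle `Pr : Preds` whose frame
class implies the V12 frame class `FrameOK` (`hPr`; true by `rfl` for V12–V14 and for any later bundle that only STRENGTHENS `FrameOK`, e.g. by a
degree clause) and every window `W`:

* `volumeLimitP2_of_carrierTexts` — `VolumeLimitP2 Pr FinalTwoLegVolLimitEx W` from, in the generic prefix, (i) the `stub_vl_bound` text, (ii) the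
  `stub_vl_sixBound` text, (iii) the «cauchy» v3 `stub_vl_carrierRate` text (same-cutoff two-volume rate of the bare last-scale self-energy with torus modulus,
  arbitrary volume pairs) — the pointwise chain is k3c5-p2's (`kler_carrierRate_of_sameCutoff`, `kler_occRate_of_carrierRate`,
  `kler_sixRate_of_carrierRate_occRate`) ∘ k3c5-p3's cutoff removal (`cutoffFreeRate_of_bareRates`, `twoVolumeRate_of_cutoffFreeRate`) ∘ k3c4-p1's Cauchy
  bridge (`exists_finalTwoLegVolLimit_of_twoVolumeRate`);
* `volumeLimitP2_of_nestedCarrierTexts` — the same with (iii) replaced by the NESTED export (iii-N) + one-volume modulus (iii-M) of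
  `…VolumeLimitNestedCarrierRate` («nested volumes suffice»).

So a future VL child `VolumeLimitP2 klPredsVxx FinalTwoLegVolLimitEx klWindowC` closes in ONE line from its three landed stubs, whatever `xx`.
Everything is proved; no definition; nothing is asserted about the model.
-/

noncomputable section

namespace Summit.HubbardSuperconductivity.HubbardSuperconductivity.Theorems.TwoPointAssembly

set_option linter.dupNamespace false -- summit = problem name (single-conjunct summit), D-0017

open Finset Filter Topology Literature.MathematicalPhysics.QuantumLattice Literature.Probability.LatticeModels
open Literature.MathematicalPhysics.QuantumLattice.FermiRG
open Summit.HubbardSuperconductivity.HubbardSuperconductivity.Theorems.DispersionFlow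
open Summit.HubbardSuperconductivity.HubbardSuperconductivity.Theorems.KLRegimeSplit
open Summit.HubbardSuperconductivity.HubbardSuperconductivity.Theorems.KLProgrammeLegKernels
open Summit.HubbardSuperconductivity.HubbardSuperconductivity.Theorems.KLRegimeVolumeLimit (kler_carrierRate_of_sameCutoff
  kler_occRate_of_carrierRate kler_sixRate_of_carrierRate_occRate)

/-! ## §1 The pointwise chain at one regime point -/

/-- **One regime point: bound + six-point bound + same-cutoff bare carrier rate ⇒ the `∃`-slot `FinalTwoLegVolLimitEx β U μ K Mstar`** (any admissible
frame of the V12 class `FrameOK`, `β > 0`, `U > 0`). -/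
theorem finalTwoLegVolLimitEx_of_carrierRate_point {R : RenConsts} {U : ℝ} {N : ℕ} {μ β : ℝ} {K : TrigPolyC4v} (hβ : 0 < β) (hU : 0 < U)
    (hK : FrameOK R U N μ K) (Mstar : ℕ → ℕ)
    (hbound : ∃ B : ℝ, ∃ L₀ : ℕ, ∃ Mth : ℕ → ℕ, ∀ (L : ℕ) [NeZero L], L₀ ≤ L → ∀ (M : ℕ) [NeZero M], Mth L ≤ M →
      ∀ (k : FreqMomentum L M) (σ : Fin 2), ‖klSelfEnergy L M β U μ K klE0 (nScales β + 1) k σ‖ ≤ B)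
    (hsix : ∃ L₀ : ℕ, ∃ B : ℝ, ∀ (L : ℕ) [NeZero L], L₀ ≤ L → ∀ (n : ℤ) (k : TorusSite 2 L), ‖klSixInf L β U μ n k‖ ≤ B)
    (hcar : ∃ L₀ : ℕ, ∃ D : ℝ, ∃ ρ : ℕ → ℝ, Tendsto ρ atTop (𝓝 0) ∧
      ∀ (L : ℕ) [NeZero L], L₀ ≤ L → ∀ (L' : ℕ) [NeZero L'], L ≤ L' → ∃ M₀ : ℕ, ∀ (M : ℕ) [NeZero M], M₀ ≤ M →
        ∀ (ω : MatsubaraIdx M) (k : TorusSite 2 L) (k' : TorusSite 2 L'),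
          ‖klSelfEnergy L M β U μ 0 klE0 (nScales β + 1) (ω, k) 0 - klSelfEnergy L' M β U μ 0 klE0 (nScales β + 1) (ω, k') 0‖ ≤
            ρ L + D * ∑ i, torusAbs (latticeMomentum L k i - latticeMomentum L' k' i)) :
    FinalTwoLegVolLimitEx β U μ K Mstar := by
  obtain ⟨B, L₀b, Mthb, hB⟩ := hbound
  obtain ⟨L₀s, Bs, hBs⟩ := hsix
  obtain ⟨L₀c, D, ρ, hρ, hS⟩ := hcar
  have hU0 : U ≠ 0 := hU.ne'
  -- the modulus term vanishes at the zone centre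
  have hzero : ∀ (L₁ L₂ : ℕ), ∑ i, torusAbs (latticeMomentum L₁ (0 : TorusSite 2 L₁) i - latticeMomentum L₂ (0 : TorusSite 2 L₂) i) = 0 := by
    intro L₁ L₂
    refine Finset.sum_eq_zero fun i _ => ?_
    have h0 : ∀ L₃ : ℕ, latticeMomentum L₃ (0 : TorusSite 2 L₃) i = 0 := fun L₃ => by simp [latticeMomentum]
    rw [h0, h0, sub_zero]
    exact klvc_torusAbs_zero
  -- cutoff-free bare carrier rate, density rate, six-point rate beyond `max L₀c 3`
  set L₁ : ℕ := max (max L₀c 3) L₀s with hL₁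
  have hcarInf : ∀ (L : ℕ) [NeZero L], L₁ ≤ L → ∀ (L' : ℕ) [NeZero L'], L ≤ L' → ∀ (n : ℤ) (k : TorusSite 2 L) (k' : TorusSite 2 L'),
      ‖klSelfEnergyInf L β U μ 0 n k - klSelfEnergyInf L' β U μ 0 n k'‖ ≤
        ρ L + D * ∑ i, torusAbs (latticeMomentum L k i - latticeMomentum L' k' i) := by
    intro L _ hL L' _ hLL' n k k'
    have hL3 : 3 ≤ L := (le_max_right _ _).trans ((le_max_left _ _).trans hL)
    have hLc : L₀c ≤ L := (le_max_left _ _).trans ((le_max_left _ _).trans hL)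
    obtain ⟨M₀, hM₀⟩ := hS L hLc L' hLL'
    exact kler_carrierRate_of_sameCutoff hβ U μ 0 hL3 (hL3.trans hLL') ⟨M₀, fun M _ hM ω _ => hM₀ M hM ω k k'⟩
  have hocc : ∀ (L : ℕ) [NeZero L], L₁ ≤ L → ∀ (L' : ℕ) [NeZero L'], L ≤ L' → ‖klOccInf L β U μ - klOccInf L' β U μ‖ ≤ ρ L / U := by
    intro L _ hL L' _ hLL'
    have hcarn : ∀ n : ℕ, ‖klSelfEnergyInf L β U μ 0 (n : ℤ) 0 - klSelfEnergyInf L' β U μ 0 (n : ℤ) 0‖ ≤ ρ L := by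
      intro n
      have h1 := hcarInf L hL L' hLL' (n : ℤ) 0 0
      rwa [hzero, mul_zero, add_zero] at h1
    have h2 := kler_occRate_of_carrierRate hβ hU0 μ hcarn
    rwa [abs_of_pos hU] at h2
  have hsixR : ∀ (L : ℕ) [NeZero L], L₁ ≤ L → ∀ (L' : ℕ) [NeZero L'], L ≤ L' → ∀ (n : ℤ) (k : TorusSite 2 L) (k' : TorusSite 2 L'),
      ‖klSixInf L β U μ n k - klSixInf L' β U μ n k'‖ ≤
        (ρ L + |U| * (ρ L / U)) / U ^ 2 + D / U ^ 2 * ∑ i, torusAbs (latticeMomentum L k i - latticeMomentum L' k' i) := by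
    intro L _ hL L' _ hLL' n k k'
    have h := kler_sixRate_of_carrierRate_occRate hβ.ne' hU0 μ (hcarInf L hL L' hLL' n k k') (hocc L hL L' hLL')
    calc _ ≤ (ρ L + D * ∑ i, torusAbs (latticeMomentum L k i - latticeMomentum L' k' i) + |U| * (ρ L / U)) / U ^ 2 := h
      _ = (ρ L + |U| * (ρ L / U)) / U ^ 2 + D / U ^ 2 * ∑ i, torusAbs (latticeMomentum L k i - latticeMomentum L' k' i) := by ring
  have hsixB : ∀ (L : ℕ) [NeZero L], L₁ ≤ L → ∀ (n : ℤ) (k : TorusSite 2 L), ‖klSixInf L β U μ n k‖ ≤ Bs :=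
    fun L _ hL n k => hBs L ((le_max_right _ _).trans hL) n k
  have hρ₁ : Tendsto (fun L => ρ L / U) atTop (𝓝 0) := by simpa using hρ.div_const U
  have hρ₂ : Tendsto (fun L => (ρ L + |U| * (ρ L / U)) / U ^ 2) atTop (𝓝 0) := by
    have h := ((hρ.add ((hρ.div_const U).const_mul |U|)).div_const (U ^ 2))
    simpa using h
  -- frame dressing, cutoff removal, then the Cauchy bridge
  obtain ⟨D', ρ', hρ', hvol⟩ := cutoffFreeRate_of_bareRates hβ hK U (L₀ := L₁) hρ₁ hρ₂ hocc hsixR hsixB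
  obtain ⟨L₂, Mth, D'', ρ'', hρ'', hrate⟩ := twoVolumeRate_of_cutoffFreeRate hβ U μ K hρ' hvol
  exact exists_finalTwoLegVolLimit_of_twoVolumeRate (L₀ := max L₀b L₂) (Mth := fun L => max (Mthb L) (Mth L)) (B := B) (D := D'') hρ''
    (fun L _ hL M _ hM k σ => hB L (le_of_max_le_left hL) M (le_of_max_le_left hM) k σ)
    (fun L _ hL M _ hM L' _ hLL' M' _ hM' σ ω ω' hωω' k k' =>
      hrate L (le_of_max_le_right hL) M (le_of_max_le_right hM) L' hLL' M' (le_of_max_le_right hM') σ ω ω' hωω' k k')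

/-! ## §2 The generic closure of a VL child from its three stub texts -/

/-- **GENERIC CLOSURE of a VL child `VolumeLimitP2 Pr FinalTwoLegVolLimitEx W`** (any bundle `Pr` whose frame class implies `FrameOK`, any window `W`)
from the three texts of skeleton «cauchy» v3 stated in the bundle's own prefix: (i) bound, (ii) six-point bound, (iii) ONE same-cutoff carrier export. -/
theorem volumeLimitP2_of_carrierTexts (Pr : Preds) (W : Set ℝ)
    (hPr : ∀ (R : RenConsts) (U : ℝ) (N : ℕ) (μ : ℝ) (K : TrigPolyC4v), Pr.frameOK R U N μ K → FrameOK R U N μ K)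
    (hbound : ∀ (G : GeoConsts) (P : SplitConsts) (Q : EngConsts) (R : RenConsts), G.WF → P.WF → Q.WF → R.WF →
      ∃ c₅ : ℝ, 0 < c₅ ∧ ∀ c : ℝ, 0 < c → c ≤ c₅ → ∃ U₀ : ℝ, 0 < U₀ ∧
        ∀ μ ∈ W, ∀ U : ℝ, 0 < U → U ≤ U₀ → ∀ β : ℝ, klBetaMin ≤ β → β ≤ Real.exp (c / U ^ 2) →
          ∀ K : TrigPolyC4v, Pr.frameOK R U (nScales β) μ K →
            ∀ (Lstar : ℕ) (Mstar : ℕ → ℕ), TowerP Pr G P Q R β U μ K Lstar Mstar →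
              ∃ B : ℝ, ∃ L₀ : ℕ, ∃ Mth : ℕ → ℕ, ∀ (L : ℕ) [NeZero L], L₀ ≤ L → ∀ (M : ℕ) [NeZero M], Mth L ≤ M →
                ∀ (k : FreqMomentum L M) (σ : Fin 2), ‖klSelfEnergy L M β U μ K klE0 (nScales β + 1) k σ‖ ≤ B)
    (hsix : ∀ (G : GeoConsts) (P : SplitConsts) (Q : EngConsts) (R : RenConsts), G.WF → P.WF → Q.WF → R.WF →
      ∃ c₅ : ℝ, 0 < c₅ ∧ ∀ c : ℝ, 0 < c → c ≤ c₅ → ∃ U₀ : ℝ, 0 < U₀ ∧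
        ∀ μ ∈ W, ∀ U : ℝ, 0 < U → U ≤ U₀ → ∀ β : ℝ, klBetaMin ≤ β → β ≤ Real.exp (c / U ^ 2) →
          ∀ K : TrigPolyC4v, Pr.frameOK R U (nScales β) μ K →
            ∀ (Lstar : ℕ) (Mstar : ℕ → ℕ), TowerP Pr G P Q R β U μ K Lstar Mstar →
              ∃ L₀ : ℕ, ∃ B : ℝ, ∀ (L : ℕ) [NeZero L], L₀ ≤ L → ∀ (n : ℤ) (k : TorusSite 2 L), ‖klSixInf L β U μ n k‖ ≤ B)
    (hcar : ∀ (G : GeoConsts) (P : SplitConsts) (Q : EngConsts) (R : RenConsts), G.WF → P.WF → Q.WF → R.WF →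
      ∃ c₅ : ℝ, 0 < c₅ ∧ ∀ c : ℝ, 0 < c → c ≤ c₅ → ∃ U₀ : ℝ, 0 < U₀ ∧
        ∀ μ ∈ W, ∀ U : ℝ, 0 < U → U ≤ U₀ → ∀ β : ℝ, klBetaMin ≤ β → β ≤ Real.exp (c / U ^ 2) →
          ∀ K : TrigPolyC4v, Pr.frameOK R U (nScales β) μ K →
            ∀ (Lstar : ℕ) (Mstar : ℕ → ℕ), TowerP Pr G P Q R β U μ K Lstar Mstar →
              ∃ L₀ : ℕ, ∃ D : ℝ, ∃ ρ : ℕ → ℝ, Tendsto ρ atTop (𝓝 0) ∧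
                ∀ (L : ℕ) [NeZero L], L₀ ≤ L → ∀ (L' : ℕ) [NeZero L'], L ≤ L' → ∃ M₀ : ℕ, ∀ (M : ℕ) [NeZero M], M₀ ≤ M →
                  ∀ (ω : MatsubaraIdx M) (k : TorusSite 2 L) (k' : TorusSite 2 L'),
                    ‖klSelfEnergy L M β U μ 0 klE0 (nScales β + 1) (ω, k) 0 -
                        klSelfEnergy L' M β U μ 0 klE0 (nScales β + 1) (ω, k') 0‖ ≤
                      ρ L + D * ∑ i, torusAbs (latticeMomentum L k i - latticeMomentum L' k' i)) :
    VolumeLimitP2 Pr FinalTwoLegVolLimitEx W := by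
  intro G P Q R hG hP hQ hR
  obtain ⟨c₁, hc₁, h₁⟩ := hbound G P Q R hG hP hQ hR
  obtain ⟨c₂, hc₂, h₂⟩ := hsix G P Q R hG hP hQ hR
  obtain ⟨c₃, hc₃, h₃⟩ := hcar G P Q R hG hP hQ hR
  refine ⟨min c₁ (min c₂ c₃), lt_min hc₁ (lt_min hc₂ hc₃), fun c hc hcle => ?_⟩
  obtain ⟨U₁, hU₁, h₁'⟩ := h₁ c hc (hcle.trans (min_le_left _ _))
  obtain ⟨U₂, hU₂, h₂'⟩ := h₂ c hc (hcle.trans ((min_le_right _ _).trans (min_le_left _ _)))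
  obtain ⟨U₃, hU₃, h₃'⟩ := h₃ c hc (hcle.trans ((min_le_right _ _).trans (min_le_right _ _)))
  refine ⟨min U₁ (min U₂ U₃), lt_min hU₁ (lt_min hU₂ hU₃), ?_⟩
  intro μ hμ U hU hUle β hβ hβle K hK Lstar Mstar hT
  have hβ0 : 0 < β := pos_of_klBetaMin_le hβ
  exact finalTwoLegVolLimitEx_of_carrierRate_point hβ0 hU (hPr R U (nScales β) μ K hK) Mstar
    (h₁' μ hμ U hU (hUle.trans (min_le_left _ _)) β hβ hβle K hK Lstar Mstar hT)
    (h₂' μ hμ U hU (hUle.trans ((min_le_right _ _).trans (min_le_left _ _))) β hβ hβle K hK Lstar Mstar hT)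
    (h₃' μ hμ U hU (hUle.trans ((min_le_right _ _).trans (min_le_right _ _))) β hβ hβle K hK Lstar Mstar hT)

/-- **GENERIC CLOSURE, NESTED FORM**: as `volumeLimitP2_of_carrierTexts` with the carrier export replaced by (iii-N) the NESTED same-momentum comparability
`L ∣ L″, p_{k″} = p_k` and (iii-M) a ONE-volume momentum modulus of the bare last-scale self-energy («nested volumes suffice»). -/
theorem volumeLimitP2_of_nestedCarrierTexts (Pr : Preds) (W : Set ℝ)
    (hPr : ∀ (R : RenConsts) (U : ℝ) (N : ℕ) (μ : ℝ) (K : TrigPolyC4v), Pr.frameOK R U N μ K → FrameOK R U N μ K)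
    (hbound : ∀ (G : GeoConsts) (P : SplitConsts) (Q : EngConsts) (R : RenConsts), G.WF → P.WF → Q.WF → R.WF →
      ∃ c₅ : ℝ, 0 < c₅ ∧ ∀ c : ℝ, 0 < c → c ≤ c₅ → ∃ U₀ : ℝ, 0 < U₀ ∧
        ∀ μ ∈ W, ∀ U : ℝ, 0 < U → U ≤ U₀ → ∀ β : ℝ, klBetaMin ≤ β → β ≤ Real.exp (c / U ^ 2) →
          ∀ K : TrigPolyC4v, Pr.frameOK R U (nScales β) μ K →
            ∀ (Lstar : ℕ) (Mstar : ℕ → ℕ), TowerP Pr G P Q R β U μ K Lstar Mstar →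
              ∃ B : ℝ, ∃ L₀ : ℕ, ∃ Mth : ℕ → ℕ, ∀ (L : ℕ) [NeZero L], L₀ ≤ L → ∀ (M : ℕ) [NeZero M], Mth L ≤ M →
                ∀ (k : FreqMomentum L M) (σ : Fin 2), ‖klSelfEnergy L M β U μ K klE0 (nScales β + 1) k σ‖ ≤ B)
    (hsix : ∀ (G : GeoConsts) (P : SplitConsts) (Q : EngConsts) (R : RenConsts), G.WF → P.WF → Q.WF → R.WF →
      ∃ c₅ : ℝ, 0 < c₅ ∧ ∀ c : ℝ, 0 < c → c ≤ c₅ → ∃ U₀ : ℝ, 0 < U₀ ∧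
        ∀ μ ∈ W, ∀ U : ℝ, 0 < U → U ≤ U₀ → ∀ β : ℝ, klBetaMin ≤ β → β ≤ Real.exp (c / U ^ 2) →
          ∀ K : TrigPolyC4v, Pr.frameOK R U (nScales β) μ K →
            ∀ (Lstar : ℕ) (Mstar : ℕ → ℕ), TowerP Pr G P Q R β U μ K Lstar Mstar →
              ∃ L₀ : ℕ, ∃ B : ℝ, ∀ (L : ℕ) [NeZero L], L₀ ≤ L → ∀ (n : ℤ) (k : TorusSite 2 L), ‖klSixInf L β U μ n k‖ ≤ B)
    (hN : ∀ (G : GeoConsts) (P : SplitConsts) (Q : EngConsts) (R : RenConsts), G.WF → P.WF → Q.WF → R.WF →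
      ∃ c₅ : ℝ, 0 < c₅ ∧ ∀ c : ℝ, 0 < c → c ≤ c₅ → ∃ U₀ : ℝ, 0 < U₀ ∧
        ∀ μ ∈ W, ∀ U : ℝ, 0 < U → U ≤ U₀ → ∀ β : ℝ, klBetaMin ≤ β → β ≤ Real.exp (c / U ^ 2) →
          ∀ K : TrigPolyC4v, Pr.frameOK R U (nScales β) μ K →
            ∀ (Lstar : ℕ) (Mstar : ℕ → ℕ), TowerP Pr G P Q R β U μ K Lstar Mstar →
              ∃ L₀ : ℕ, ∃ ρ : ℕ → ℝ, Tendsto ρ atTop (𝓝 0) ∧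
                ∀ (L : ℕ) [NeZero L], L₀ ≤ L → ∀ (L'' : ℕ) [NeZero L''], L ∣ L'' → ∃ M₀ : ℕ, ∀ (M : ℕ) [NeZero M], M₀ ≤ M →
                  ∀ (ω : MatsubaraIdx M) (k : TorusSite 2 L) (k'' : TorusSite 2 L''), latticeMomentum L'' k'' = latticeMomentum L k →
                    ‖klSelfEnergy L M β U μ 0 klE0 (nScales β + 1) (ω, k) 0 -
                        klSelfEnergy L'' M β U μ 0 klE0 (nScales β + 1) (ω, k'') 0‖ ≤ ρ L)
    (hM : ∀ (G : GeoConsts) (P : SplitConsts) (Q : EngConsts) (R : RenConsts), G.WF → P.WF → Q.WF → R.WF →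
      ∃ c₅ : ℝ, 0 < c₅ ∧ ∀ c : ℝ, 0 < c → c ≤ c₅ → ∃ U₀ : ℝ, 0 < U₀ ∧
        ∀ μ ∈ W, ∀ U : ℝ, 0 < U → U ≤ U₀ → ∀ β : ℝ, klBetaMin ≤ β → β ≤ Real.exp (c / U ^ 2) →
          ∀ K : TrigPolyC4v, Pr.frameOK R U (nScales β) μ K →
            ∀ (Lstar : ℕ) (Mstar : ℕ → ℕ), TowerP Pr G P Q R β U μ K Lstar Mstar →
              ∃ L₀ : ℕ, ∃ D : ℝ, ∃ ρ' : ℕ → ℝ, Tendsto ρ' atTop (𝓝 0) ∧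
                ∀ (L : ℕ) [NeZero L], L₀ ≤ L → ∃ M₀ : ℕ, ∀ (M : ℕ) [NeZero M], M₀ ≤ M →
                  ∀ (ω : MatsubaraIdx M) (k₁ k₂ : TorusSite 2 L),
                    ‖klSelfEnergy L M β U μ 0 klE0 (nScales β + 1) (ω, k₁) 0 -
                        klSelfEnergy L M β U μ 0 klE0 (nScales β + 1) (ω, k₂) 0‖ ≤
                      ρ' L + D * ∑ i, torusAbs (latticeMomentum L k₁ i - latticeMomentum L k₂ i)) :
    VolumeLimitP2 Pr FinalTwoLegVolLimitEx W := by
  refine volumeLimitP2_of_carrierTexts Pr W hPr hbound hsix ?_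
  intro G P Q R hG hP hQ hR
  obtain ⟨c₁, hc₁, h₁⟩ := hN G P Q R hG hP hQ hR
  obtain ⟨c₂, hc₂, h₂⟩ := hM G P Q R hG hP hQ hR
  refine ⟨min c₁ c₂, lt_min hc₁ hc₂, fun c hc hcle => ?_⟩
  obtain ⟨U₁, hU₁, h₁'⟩ := h₁ c hc (hcle.trans (min_le_left _ _))
  obtain ⟨U₂, hU₂, h₂'⟩ := h₂ c hc (hcle.trans (min_le_right _ _))
  refine ⟨min U₁ U₂, lt_min hU₁ hU₂, ?_⟩
  intro μ hμ U hU hUle β hβ hβle K hK Lstar Mstar hT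
  obtain ⟨L₁, ρ, hρ, hnest⟩ := h₁' μ hμ U hU (hUle.trans (min_le_left _ _)) β hβ hβle K hK Lstar Mstar hT
  obtain ⟨L₂, D, ρ', hρ', hmod⟩ := h₂' μ hμ U hU (hUle.trans (min_le_right _ _)) β hβ hβle K hK Lstar Mstar hT
  obtain ⟨ρ₂, hρ₂, hrate⟩ := twoVolumeRate_of_nestedRate_cutoff
    (T := fun L M _ _ ω k => klSelfEnergy L M β U μ 0 klE0 (nScales β + 1) (ω, k) 0) (L₀ := max L₁ L₂) (D := D) hρ hρ'
    (fun L _ hL L'' _ hdvd => hnest L (le_of_max_le_left hL) L'' hdvd) (fun L _ hL => hmod L (le_of_max_le_right hL))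
  exact ⟨max L₁ L₂, D, ρ₂, hρ₂, fun L _ hL L' _ hLL' => hrate L hL L' hLL'⟩

/-- The instance of record: the gen-5 VL child (`klPredsV14.frameOK = FrameOK` by `rfl`) — the «cauchy» v3 composition in one line. -/
theorem klRegimeVolumeLimitV14_of_carrierTexts
    (hbound : ∀ (G : GeoConsts) (P : SplitConsts) (Q : EngConsts) (R : RenConsts), G.WF → P.WF → Q.WF → R.WF →
      ∃ c₅ : ℝ, 0 < c₅ ∧ ∀ c : ℝ, 0 < c → c ≤ c₅ → ∃ U₀ : ℝ, 0 < U₀ ∧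
        ∀ μ ∈ klWindowC, ∀ U : ℝ, 0 < U → U ≤ U₀ → ∀ β : ℝ, klBetaMin ≤ β → β ≤ Real.exp (c / U ^ 2) →
          ∀ K : TrigPolyC4v, klPredsV14.frameOK R U (nScales β) μ K →
            ∀ (Lstar : ℕ) (Mstar : ℕ → ℕ), TowerP klPredsV14 G P Q R β U μ K Lstar Mstar →
              ∃ B : ℝ, ∃ L₀ : ℕ, ∃ Mth : ℕ → ℕ, ∀ (L : ℕ) [NeZero L], L₀ ≤ L → ∀ (M : ℕ) [NeZero M], Mth L ≤ M →
                ∀ (k : FreqMomentum L M) (σ : Fin 2), ‖klSelfEnergy L M β U μ K klE0 (nScales β + 1) k σ‖ ≤ B)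
    (hsix : ∀ (G : GeoConsts) (P : SplitConsts) (Q : EngConsts) (R : RenConsts), G.WF → P.WF → Q.WF → R.WF →
      ∃ c₅ : ℝ, 0 < c₅ ∧ ∀ c : ℝ, 0 < c → c ≤ c₅ → ∃ U₀ : ℝ, 0 < U₀ ∧
        ∀ μ ∈ klWindowC, ∀ U : ℝ, 0 < U → U ≤ U₀ → ∀ β : ℝ, klBetaMin ≤ β → β ≤ Real.exp (c / U ^ 2) →
          ∀ K : TrigPolyC4v, klPredsV14.frameOK R U (nScales β) μ K →
            ∀ (Lstar : ℕ) (Mstar : ℕ → ℕ), TowerP klPredsV14 G P Q R β U μ K Lstar Mstar →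
              ∃ L₀ : ℕ, ∃ B : ℝ, ∀ (L : ℕ) [NeZero L], L₀ ≤ L → ∀ (n : ℤ) (k : TorusSite 2 L), ‖klSixInf L β U μ n k‖ ≤ B)
    (hcar : ∀ (G : GeoConsts) (P : SplitConsts) (Q : EngConsts) (R : RenConsts), G.WF → P.WF → Q.WF → R.WF →
      ∃ c₅ : ℝ, 0 < c₅ ∧ ∀ c : ℝ, 0 < c → c ≤ c₅ → ∃ U₀ : ℝ, 0 < U₀ ∧
        ∀ μ ∈ klWindowC, ∀ U : ℝ, 0 < U → U ≤ U₀ → ∀ β : ℝ, klBetaMin ≤ β → β ≤ Real.exp (c / U ^ 2) →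
          ∀ K : TrigPolyC4v, klPredsV14.frameOK R U (nScales β) μ K →
            ∀ (Lstar : ℕ) (Mstar : ℕ → ℕ), TowerP klPredsV14 G P Q R β U μ K Lstar Mstar →
              ∃ L₀ : ℕ, ∃ D : ℝ, ∃ ρ : ℕ → ℝ, Tendsto ρ atTop (𝓝 0) ∧
                ∀ (L : ℕ) [NeZero L], L₀ ≤ L → ∀ (L' : ℕ) [NeZero L'], L ≤ L' → ∃ M₀ : ℕ, ∀ (M : ℕ) [NeZero M], M₀ ≤ M →
                  ∀ (ω : MatsubaraIdx M) (k : TorusSite 2 L) (k' : TorusSite 2 L'),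
                    ‖klSelfEnergy L M β U μ 0 klE0 (nScales β + 1) (ω, k) 0 -
                        klSelfEnergy L' M β U μ 0 klE0 (nScales β + 1) (ω, k') 0‖ ≤
                      ρ L + D * ∑ i, torusAbs (latticeMomentum L k i - latticeMomentum L' k' i)) :
    VolumeLimitP2 klPredsV14 FinalTwoLegVolLimitEx klWindowC :=
  volumeLimitP2_of_carrierTexts klPredsV14 klWindowC (fun _ _ _ _ _ h => h) hbound hsix hcar

end Summit.HubbardSuperconductivity.HubbardSuperconductivity.Theorems.TwoPointAssembly

end
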